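import Literature.AlgebraicGeometry.Frobenioids.ArithmeticFrobenioidsProofs
import Mathlib.NumberTheory.Cyclotomic.PrimitiveRoots
import HarnessLib

/-!
# Frobenioids I, Theorem 6.4 (i) (base part) and the Div-slim criterion of Thm. 6.2 (iv):
# the universal closures of the SCHEMATA `Thm64i_base`, `FinSubextCat.PullInjective`,
# `FinSubextCat.MovesSomeGalois` are refutable — PROOF-ONLY (kernel `¬ ∀`)

Mochizuki, *The geometry of Frobenioids I: the general theory*, Kyushu J. Math. **62** (2008) 293–400,
Theorem 6.4 (i) p. 114 ("`D` is Frobenius-slim and Div-slim …"), Theorem 6.2 (iv) p. 111 and its proof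
p. 112 (the Div-slim criterion: "for every `1 ≠ z ∈ Z`, there exists a finite Galois extension `L` … such
that `z` acts nontrivially on `Φ(L)`"). [cite: MochizukiFrdI2008, Thm. 6.4 (i) p.114]
[cite: MochizukiFrdI2008, Thm. 6.2 (iv) p.111]

PROOF-ONLY companion of `ArithmeticFrobenioids.lean` / `FinSubextCatDivSlim.lean` (cell abc-iut, F
fact-proving wave, seat abc-iut-f-016 gen 2; FROZEN FACT-LIST rows F-0887 `Thm64i_base`, F-1084
`FinSubextCat.PullInjective`, F-1083 `FinSubextCat.MovesSomeGalois`; no `def`, no `instance`, no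
`structure`: every witness is built inside a proof).  The three declarations are SCHEMATA over the
data-only operations interface (`ArithModelFrobenioid F K C`: ANY `PreFrobenioidData` over
`D = B(Gal(K/F))⁰ = FinSubextCat F K` whose divisor monoids are abstractly `≃*` the effective arithmetic
divisors — `monEquiv` carries no naturality; resp. ANY `PreFrobenioidData` over `D`).  Their own files say
so: `FinSubextCatDivSlim.lean` records pull-back injectivity as "not part of the typed interfaces" (FINDING
F3), and `ArithmeticFrobenioidsProofs.lean` notes that the interface "cannot transport" the classical input
"an automorphism of a number field fixing all valuations is the identity" to `M.ops.pull`.  This file makes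
that a KERNEL event (plan rule R5: the universal closure of a schema row is not a fact).

The countermodel (`exists_topTrivial_countermodel`, universe-polymorphic in the total category): over a
finite Galois extension `K/F` of a number field with `[K : F] > 1`, take on `D = FinSubextCat F K` THE
effective arithmetic divisors `Φ(Spec L)` with THE pull-backs (`arithDivisorMonoidOn F K`), EXCEPT that
every arrow OUT OF the object `Spec K` (the top intermediate field) pulls back trivially: identically along
`End(Spec K) = Gal(K/F)`, and by the trivial homomorphism `1` along `Spec K → Spec L`, `L ≠ K`.  Since no
arrow of `D` ENTERS `Spec K` from another object, this is still a contravariant functor (cast-free: the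
identity on `Φ(Spec K)` is written as THE pull-back along the inclusion `L ≤ K`); the total category is a
point over `Spec K` with `Div ≡ 0`, `deg_Fr ≡ 1`.  Then:
* `Thm64i_base` fails (`not_forall_Thm64i_base`): the automorphism of `D_{Spec K} → D` attached to a
  nontrivial `σ ∈ Gal(K/F)` (`FinSubextCat.autForgetOfCentralizer`, FrdI p. 112) acts trivially on every
  `Φ`, yet is nontrivial (`FinSubextCat.eq_one_of_autForgetOfCentralizer_eq_refl`) — `D` is NOT Div-slim
  for these operations, while `Thm64i_base M ↔ M.ops.IsDivSlim` (`Thm64i_base_iff_isDivSlim`);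
* `PullInjective` fails (`FinSubextCat.not_forall_pullInjective`): pull-back along `Spec K → Spec F` is
  `1`, and `Φ(Spec F) ≠ 1` (the divisor with coordinate `1` at an archimedean place);
* `MovesSomeGalois` fails when `[K : F] = 2` (`FinSubextCat.not_forall_movesSomeGalois`): the nontrivial
  `σ ∈ Z = Gal(K/F)` acts trivially on `Φ(Spec K)` by construction and on `Φ(Spec F)` because
  `End(Spec F) = {id}`, and a quadratic extension has no other intermediate field.
The closed instances are taken at `F = ℚ`, `K = ℚ(ζ₃)` (`CyclotomicField 3 ℚ`, degree `φ(3) = 2`).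

INSTANCE FORMS OF RECORD (the rows' content, all PROVED in the tree for THE arithmetic model Frobenioid
`C_{K/F}` of Ex. 6.3 / Thm. 6.4 and cited here BY NAME, `Thm64i_base_rows_arith`): `Thm64i_base_arith`
(`ArithmeticFrobenioidsProofs.lean`), `pullInjective_arith`, `movesSomeGalois_arith`
(`ArithmeticFrobenioidDivSlim.lean`).

What this does NOT say: nothing here contradicts [FrdI] Thm. 6.4 (i) or Thm. 6.2 (iv) — print's statements
are about THE divisor monoid `Φ` of Ex. 6.3 with THE pull-backs, for which the three rows are theorems; the
refutations only certify that the three rows cannot be consumed as closed facts over the bare interfaces.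
Classical, undisputed mathematics; nothing here bears on [IUTchIII] Cor. 3.12 or asserts anything about abc;
typed ≠ proved; refuted-as-schema ≠ refuted-in-print; no side taken.
-/

noncomputable section

namespace Literature.AlgebraicGeometry.Frobenioids

open CategoryTheory

universe u v

/-! ### Two elementary facts about `D = FinSubextCat F K` for a finite Galois `K/F` -/

/-- In `D = B(Gal(K/F))⁰`, `K/F` finite, an arrow `Spec L' → Spec K` (an `F`-algebra map `K → L' ⊆ K`)
forces `L' = K`. [cite: MochizukiFrdI2008, Ex. 6.3 p.113] -/
theorem FinSubextCat.eq_top_of_hom {F K : Type u} [Field F] [Field K] [Algebra F K] [FiniteDimensional F K]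
    {X Y : FinSubextCat F K} (m : Y ⟶ X) (hX : X.L = ⊤) : Y.L = ⊤ := by
  refine IntermediateField.eq_of_le_of_finrank_le le_top ?_
  rw [← hX]
  exact LinearMap.finrank_le_finrank_of_injective (f := m.toAlgHom.toLinearMap)
    m.toAlgHom.toRingHom.injective

/-- In a quadratic extension the intermediate fields are `⊥` and `⊤`. [cite: MochizukiFrdI2008, Ex. 6.3 p.113] -/
theorem FinSubextCat.eq_bot_or_eq_top_of_finrank_eq_two {F K : Type u} [Field F] [Field K] [Algebra F K]
    [FiniteDimensional F K] (h2 : Module.finrank F K = 2) (L : IntermediateField F K) : L = ⊥ ∨ L = ⊤ := by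
  have hmul : Module.finrank F L * Module.finrank L K = 2 := by
    rw [Module.finrank_mul_finrank, h2]
  have hdvd : Module.finrank F L ∣ 2 := ⟨_, hmul.symm⟩
  rcases (Nat.dvd_prime Nat.prime_two).mp hdvd with h1 | h2'
  · exact Or.inl (IntermediateField.finrank_eq_one_iff.mp h1)
  · refine Or.inr (IntermediateField.eq_of_le_of_finrank_eq le_top ?_)
    rw [h2', IntermediateField.finrank_top', h2]

/-! ### The countermodel: THE arithmetic divisors, with trivial pull-backs out of `Spec K` -/

/-- **Countermodel for the three schemata** (see the file header): for a finite Galois extension `K/F` of a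
number field with `[K : F] > 1` there are, in every universe, a (one-point) total category `T` and an
`ArithModelFrobenioid F K T` — THE effective arithmetic divisors with THE pull-backs on `D = FinSubextCat F K`
except that every arrow out of `Spec K` pulls back trivially — whose operations are NOT Div-slim (Def. 4.5
(iv)), do NOT have injective pull-backs, and, when `[K : F] = 2`, under which NO `1 ≠ z ∈ Z` moves any
divisor of any finite Galois `L`. [cite: MochizukiFrdI2008, Thm. 6.2 (iv) p.112] -/
theorem exists_topTrivial_countermodel (F K : Type) [Field F] [NumberField F] [Field K] [Algebra F K]
    [FiniteDimensional F K] [IsGalois F K] (hK : 1 < Module.finrank F K) :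
    ∃ (T : Type u) (_ : Category.{v} T) (M : ArithModelFrobenioid F K T),
      ¬ M.ops.IsDivSlim ∧ ¬ FinSubextCat.PullInjective M.ops ∧
        (Module.finrank F K = 2 → ¬ FinSubextCat.MovesSomeGalois M.ops) := by
  classical
  -- a nontrivial element of `Gal(K/F)`
  obtain ⟨σ, hσ⟩ : ∃ σ : K ≃ₐ[F] K, σ ≠ 1 := by
    haveI : Nontrivial (K ≃ₐ[F] K) :=
      Finite.one_lt_card_iff_nontrivial.mp (by rwa [IsGalois.card_aut_eq_finrank])
    exact exists_ne 1
  -- `⊥ ≠ ⊤` among the intermediate fields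
  have hbt : (⊥ : IntermediateField F K) ≠ ⊤ := by
    intro h
    have h1 : Module.finrank F (⊤ : IntermediateField F K) = 1 := by
      rw [← h, IntermediateField.finrank_bot]
    rw [IntermediateField.finrank_top'] at h1
    omega
  -- the one-point total category
  letI instT : Category.{v} PUnit.{u + 1} :=
    { Hom := fun _ _ => PUnit.{v + 1}
      id := fun _ => PUnit.unit
      comp := fun _ _ => PUnit.unit
      id_comp := fun _ => rfl
      comp_id := fun _ => rfl
      assoc := fun _ _ _ => rfl }
  let X₁ : FinSubextCat F K := ⟨⊤⟩
  let X₀ : FinSubextCat F K := ⟨⊥⟩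
  let G := arithDivisorMonoidOn F K
  -- THE pull-back along the inclusion `X.L ≤ K = Y.L` (an arrow `Y ⟶ X` when `Y.L = ⊤`)
  let ι : ∀ (X Y : FinSubextCat F K), Y.L = ⊤ → (Y ⟶ X) := fun X Y hY =>
    ⟨IntermediateField.inclusion (le_top.trans_eq hY.symm)⟩
  have hι_self : ∀ (X : FinSubextCat F K) (hX : X.L = ⊤), ι X X hX = 𝟙 X := fun X hX =>
    FinSubextCat.hom_ext (AlgHom.ext fun _ => rfl)
  have hι_comp : ∀ (X Y Z : FinSubextCat F K) (hY : Y.L = ⊤) (hZ : Z.L = ⊤),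
      ι Y Z hZ ≫ ι X Y hY = ι X Z hZ := fun X Y Z hY hZ =>
    FinSubextCat.hom_ext (AlgHom.ext fun _ => rfl)
  let S : PreFrobenioidData.{0} PUnit.{u + 1} (FinSubextCat F K) :=
    { base := (Functor.const _).obj X₁
      Mon := fun X => Multiplicative (EffArithDivisor X.L)
      pull := fun {X Y} m =>
        if hY : Y.L = ⊤ then (if X.L = ⊤ then G.pull (ι X Y hY) else 1) else G.pull m
      pull_id := fun X x => by
        by_cases hX : X.L = ⊤
        · simp only [dif_pos hX, if_pos hX, hι_self]
          exact G.pull_id X x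
        · simp only [dif_neg hX]
          exact G.pull_id X x
      pull_comp := fun {X Y Z} β α x => by
        by_cases hZ : Z.L = ⊤
        · by_cases hY : Y.L = ⊤
          · by_cases hX : X.L = ⊤
            · simp only [dif_pos hZ, dif_pos hY, if_pos hX, if_pos hY]
              rw [← G.pull_comp, hι_comp X Y Z hY hZ]
            · simp only [dif_pos hZ, dif_pos hY, if_neg hX, if_pos hY, MonoidHom.one_apply, map_one]
          · have hX : ¬ X.L = ⊤ := fun hX => hY (FinSubextCat.eq_top_of_hom α hX)
            simp only [dif_pos hZ, dif_neg hY, if_neg hX, if_neg hY, MonoidHom.one_apply]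
        · have hY : ¬ Y.L = ⊤ := fun hY => hZ (FinSubextCat.eq_top_of_hom β hY)
          simp only [dif_neg hZ, dif_neg hY]
          exact G.pull_comp β α x
      div := fun _ => 1
      degFr := fun _ => 1
      div_id := fun _ => rfl
      div_comp := fun _ _ => by simp
      degFr_id := fun _ => rfl
      degFr_comp := fun _ _ => rfl }
  -- every endomorphism of `Spec K` pulls back identically
  have htop : ∀ (X : FinSubextCat F K) (f : X ⟶ X), X.L = ⊤ → ∀ x : S.Mon X, S.pull f x = x := by
    intro X f hX x
    show (if hY : X.L = ⊤ then (if X.L = ⊤ then G.pull (ι X X hY) else 1) else G.pull f) x = x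
    simp only [dif_pos hX, if_pos hX, hι_self]
    exact G.pull_id X x
  -- every arrow `Spec K → Spec L`, `L ≠ K`, pulls back by `1`
  have hout : ∀ (X Y : FinSubextCat F K) (m : Y ⟶ X), Y.L = ⊤ → X.L ≠ ⊤ →
      ∀ x : S.Mon X, S.pull m x = 1 := by
    intro X Y m hY hX x
    show (if hY : Y.L = ⊤ then (if X.L = ⊤ then G.pull (ι X Y hY) else 1) else G.pull m) x = 1
    simp only [dif_pos hY, if_neg hX, MonoidHom.one_apply]
  refine ⟨PUnit.{u + 1}, instT, { ops := S, monEquiv := fun _ => MulEquiv.refl _ }, ?_, ?_, ?_⟩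
  · -- NOT Div-slim: the automorphism of `D_{Spec K} → D` attached to `σ` acts trivially on `Φ`
    intro h
    have hz : ∀ g ∈ X₁.L.fixingSubgroup, σ * g = g * σ := by
      intro g hg
      have hg1 : g = 1 := by
        rwa [show X₁.L = ⊤ from rfl, IntermediateField.fixingSubgroup_top, Subgroup.mem_bot] at hg
      rw [hg1, mul_one, one_mul]
    have h1 := h.eq_one X₁ (FinSubextCat.autForgetOfCentralizer hz) fun B x =>
      htop B.left _ (FinSubextCat.eq_top_of_hom B.hom rfl) x
    exact hσ (FinSubextCat.eq_one_of_autForgetOfCentralizer_eq_refl hz h1)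
  · -- pull-back along `Spec K → Spec F` is `1`, not injective
    intro hinj
    haveI : NumberField (⊥ : IntermediateField F K) := NumberField.of_module_finite F _
    obtain ⟨w⟩ := (inferInstance : Nonempty (NumberField.InfinitePlace (⊥ : IntermediateField F K)))
    let D : EffArithDivisor (⊥ : IntermediateField F K) := (0, fun _ => 1)
    let m : X₁ ⟶ X₀ := ⟨IntermediateField.inclusion bot_le⟩
    have key : S.pull m (Multiplicative.ofAdd D) = S.pull m 1 := by
      rw [hout X₀ X₁ m rfl hbt, hout X₀ X₁ m rfl hbt]
    have hD0 : D = 0 := Multiplicative.ofAdd.injective (hinj m key)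
    have h2 : D.2 w = 0 := by rw [hD0]; rfl
    exact one_ne_zero h2
  · -- for `[K : F] = 2`: `σ ∈ Z` moves no divisor of any finite Galois `L` (`L = F` or `L = K`)
    intro h2 hmv
    have hmem : σ ∈ commOpenSubgroup F K := by
      refine ⟨(⊤ : IntermediateField F K).fixingSubgroup, IntermediateField.fixingSubgroup_isOpen ⊤, ?_⟩
      intro g hg
      have hg1 : g = 1 := by
        rwa [IntermediateField.fixingSubgroup_top, Subgroup.mem_bot] at hg
      rw [hg1, mul_one, one_mul]
    obtain ⟨X, _, τ, hτ, x, hx⟩ := hmv σ hmem hσ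
    rcases FinSubextCat.eq_bot_or_eq_top_of_finrank_eq_two h2 X.L with hX | hX
    · -- `X = Spec F`: its only endomorphism is the identity
      have hτ1 : τ = 𝟙 X := by
        refine FinSubextCat.hom_ext (AlgHom.ext fun a => Subtype.ext ?_)
        have ha : ((a : X.L) : K) ∈ (⊥ : IntermediateField F K) := by rw [← hX]; exact a.2
        obtain ⟨r, hr⟩ := IntermediateField.mem_bot.mp ha
        show ((τ.toAlgHom a : X.L) : K) = (a : K)
        rw [hτ, ← hr, AlgEquiv.commutes]
      apply hx
      rw [hτ1]
      exact S.pull_id X x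
    · exact hx (htop X τ hX x)

/-! ### The three universal closures refuted (at `F = ℚ`, `K = ℚ(ζ₃)`) -/

/-- `ℚ(ζ₃) = CyclotomicField 3 ℚ` is Galois of degree `2` over `ℚ`. [cite: MochizukiFrdI2008, Ex. 6.3 p.113] -/
theorem cyclotomicField_three_isGalois_and_finrank :
    IsGalois ℚ (CyclotomicField 3 ℚ) ∧ Module.finrank ℚ (CyclotomicField 3 ℚ) = 2 := by
  haveI : IsCyclotomicExtension {3} ℚ (CyclotomicField 3 ℚ) := CyclotomicField.isCyclotomicExtension 3 ℚ
  refine ⟨IsCyclotomicExtension.isGalois {3} ℚ (CyclotomicField 3 ℚ), ?_⟩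
  rw [IsCyclotomicExtension.finrank (n := 3) (CyclotomicField 3 ℚ)
    (Polynomial.cyclotomic.irreducible_rat (by norm_num))]
  decide

/-- **F-0887 / `Thm64i_base` ([FrdI] Thm. 6.4 (i) p. 114, base part: "`D` is Frobenius-slim and Div-slim …
and slim iff `Z = {1}`") — universal closure REFUTED**: over the data-only `M : ArithModelFrobenioid F K C`
the Div-slim conjunct fails for the operations of `exists_topTrivial_countermodel` at `K/F = ℚ(ζ₃)/ℚ`.  The
row is a theorem for THE arithmetic model Frobenioid: `Thm64i_base_arith` (instance form of record).
[cite: MochizukiFrdI2008, Thm. 6.4 (i) p.114] -/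
theorem not_forall_Thm64i_base :
    ¬ ∀ (F : Type) [Field F] [NumberField F] (K : Type) [Field K] [Algebra F K]
        (C : Type u) [Category.{v} C] (M : ArithModelFrobenioid F K C),
        Literature.AlgebraicGeometry.Frobenioids.Thm64i_base M := by
  intro h
  obtain ⟨hgal, h2⟩ := cyclotomicField_three_isGalois_and_finrank
  haveI := hgal
  obtain ⟨T, _, M, hds, -, -⟩ :=
    exists_topTrivial_countermodel.{u, v} ℚ (CyclotomicField 3 ℚ) (by omega)
  exact hds ((Thm64i_base_iff_isDivSlim M).mp (h ℚ (CyclotomicField 3 ℚ) T M))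

/-- **F-1084 / `FinSubextCat.PullInjective` ([FrdI] Thm. 6.2 (iv), proof p. 112: pull-back of divisors
along the arrows of `D` is injective — "holds in the models of Ex. 6.1 / Ex. 6.3; not part of the typed
interfaces") — universal closure REFUTED**: for the operations of `exists_topTrivial_countermodel` at
`ℚ(ζ₃)/ℚ` the pull-back along `Spec K → Spec ℚ` is the trivial homomorphism.  Instance form of record:
`pullInjective_arith`. [cite: MochizukiFrdI2008, Thm. 6.2 (iv) p.112] -/
theorem FinSubextCat.not_forall_pullInjective :
    ¬ ∀ (F : Type) [Field F] (K : Type) [Field K] [Algebra F K]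
        (C : Type u) [Category.{v} C] (S : PreFrobenioidData.{0} C (FinSubextCat F K)),
        Literature.AlgebraicGeometry.Frobenioids.FinSubextCat.PullInjective S := by
  intro h
  obtain ⟨hgal, h2⟩ := cyclotomicField_three_isGalois_and_finrank
  haveI := hgal
  obtain ⟨T, _, M, -, hinj, -⟩ :=
    exists_topTrivial_countermodel.{u, v} ℚ (CyclotomicField 3 ℚ) (by omega)
  exact hinj (h ℚ (CyclotomicField 3 ℚ) T M.ops)

/-- **F-1083 / `FinSubextCat.MovesSomeGalois` ([FrdI] Thm. 6.2 (iv) p. 111: "for every `1 ≠ z ∈ Z`, there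
exists a finite Galois extension `L` … such that `z` acts nontrivially on `Φ(L)`") — universal closure
REFUTED**: for the operations of `exists_topTrivial_countermodel` at the quadratic `ℚ(ζ₃)/ℚ`, complex
conjugation `∈ Z` acts trivially on `Φ(Spec ℚ(ζ₃))` (by construction) and on `Φ(Spec ℚ)`.  Instance form of
record: `movesSomeGalois_arith`. [cite: MochizukiFrdI2008, Thm. 6.2 (iv) p.111] -/
theorem FinSubextCat.not_forall_movesSomeGalois :
    ¬ ∀ (F : Type) [Field F] (K : Type) [Field K] [Algebra F K]
        (C : Type u) [Category.{v} C] (S : PreFrobenioidData.{0} C (FinSubextCat F K)),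
        Literature.AlgebraicGeometry.Frobenioids.FinSubextCat.MovesSomeGalois S := by
  intro h
  obtain ⟨hgal, h2⟩ := cyclotomicField_three_isGalois_and_finrank
  haveI := hgal
  obtain ⟨T, _, M, -, -, hmv⟩ :=
    exists_topTrivial_countermodel.{u, v} ℚ (CyclotomicField 3 ℚ) (by omega)
  exact hmv h2 (h ℚ (CyclotomicField 3 ℚ) T M.ops)

/-! ### The instance forms of record (junction, cited by name) -/

/-- **The content of rows F-0887 / F-1084 / F-1083 at THE data** — all PROVED in the tree and collected
here by name: for THE arithmetic model Frobenioid `C_{K/F}` of Ex. 6.3 / Thm. 6.4 (`K/F` Galois, `F` a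
number field), `Thm64i_base` holds (`Thm64i_base_arith`), divisor pull-back is injective
(`pullInjective_arith`), and every `1 ≠ z ∈ Z` moves a divisor of some finite Galois `L`
(`movesSomeGalois_arith`). [cite: MochizukiFrdI2008, Thm. 6.4 (i) p.114] -/
theorem Thm64i_base_rows_arith (F : Type) [Field F] [NumberField F] (K : Type) [Field K] [Algebra F K]
    [IsGalois F K] :
    Literature.AlgebraicGeometry.Frobenioids.Thm64i_base (arithModelFrobenioid F K) ∧
      Literature.AlgebraicGeometry.Frobenioids.FinSubextCat.PullInjective (arithFrobenioidOps F K) ∧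
        Literature.AlgebraicGeometry.Frobenioids.FinSubextCat.MovesSomeGalois (arithFrobenioidOps F K) :=
  ⟨Thm64i_base_arith F K, pullInjective_arith F K, movesSomeGalois_arith F K⟩

end Literature.AlgebraicGeometry.Frobenioids

end
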